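import Mathlib
import Summits.NavierStokesRegularity.NavierStokesRegularity.Theorems.WakeRatchetTailRatchetQuietPast
import HarnessLib

/-!
# `WakeRatchet.TailRatchet` (stmt-NavierStokesRegularity-21808) — hypothesis class of the tail ratchets:
# forward uniqueness from a zero slice and the BACKWARD AMPLITUDE FLOOR (companion of `WakeRatchetTailRatchetQuietPast`)

Support file (route `WakeRatchet`; MODEL lattice ODEs of Tao 2016 §4 in the renormalised variables of §6.4 —
nothing here is a statement about the Navier–Stokes equations; no item is closed).

With the window estimate and `eq_zero_on_quiet_past` of the companion file (an eternal solution of ANY table with ANY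
covariant viscosity `ν̂ ≥ 0` that is quiet on a past half-line vanishes there):

* `eq_zero_on_step` / `eq_zero_after_of_eq_zero` — forward uniqueness from a zero time-slice for uniformly bounded
  solutions (the window estimate on steps of length `h = 1/(8KC+1)` and the same halving induction);
* `eq_zero_of_quiet_past` — a uniformly bounded eternal solution with `‖W_k(σ)‖ ≤ δ` for all `k`, all `σ ≤ σ₁`, and
  `K δ ≤ 1/4` (`K` any bound of the table constant `C_Q + Λ C_A + Λ⁻¹ C_B`) is IDENTICALLY ZERO;
* `past_loud` / `past_loud_inviscid` — **backward amplitude floor**: a non-trivial uniformly bounded eternal solution has,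
  for every `σ₁`, a shell `n` and a log-time `σ ≤ σ₁` with `‖W_n(σ)‖ > 1/(4K)` — the non-degeneracy input of every
  α-limit extraction from the hypothesis class of stmt-21808 / 25584 / 25646 / 25647 (compare the tree's GLOBAL floor
  `WakeRatchetEternalFloor`, `sup_{n,σ}‖W‖ > 1/(896 ε₀)`, which is larger but not localised in the past).

HONEST FRAMING: elementary real analysis for a MODEL lattice ODE; stmt-21808 is neither proved nor refuted here (it stays
dead modulo the construction `WakeRatchetDyadicFront.DyadicScalarFronts`).
-/

noncomputable section

set_option linter.dupNamespace false

namespace Summit.NavierStokesRegularity.NavierStokesRegularity.Theorems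

namespace WakeRatchetQuietPast

open Set Filter Topology
open scoped RealInnerProductSpace
open Literature.Analysis.FluidPDE Literature.Analysis.FluidPDE.TaoCascade

variable {m : ℕ} {ε₀ νh : ℝ} {α : Fin m → Fin m → Fin m → ℤ × ℤ × ℤ → ℝ} {W : ℤ → ℝ → Em m}

/-! ## Forward uniqueness from a zero time-slice (uniformly bounded solutions) -/

/-- **One forward step.**  If `‖W_k‖ ≤ C` everywhere (`C ≥ 0`), `h = 1/(8KC+1)`, and every shell vanishes at
log-time `a`, then every shell vanishes on `[a, a + h]` (window estimate with `e^{2u} − e^{2a} ≤ 2h e^{2u}`, then the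
same halving induction). [cite: Tao2016AveragedNS, §4 Lemma 4.1 (4.8); cell lemma] -/
theorem eq_zero_on_step (hε : -1 < ε₀) (hW : IsEternalVisc ε₀ νh α W) {K C a : ℝ}
    (hK : shiftConst α (0, 0, 0) + bigLam ε₀ * shiftConst α (0, 0, 1)
      + (bigLam ε₀)⁻¹ * (shiftConst α (1, 0, 0) + shiftConst α (0, 1, 0)) ≤ K)
    (hC : 0 ≤ C) (hbd : ∀ (k : ℤ) (σ : ℝ), ‖W k σ‖ ≤ C) (h0 : ∀ k : ℤ, W k a = 0) :
    ∀ (n : ℤ) (u : ℝ), u ∈ Icc a (a + 1 / (8 * K * C + 1)) → W n u = 0 := by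
  have hK0 : 0 ≤ K := tableConst_nonneg hε hK
  set h : ℝ := 1 / (8 * K * C + 1) with hh
  have hden : 0 < 8 * K * C + 1 := by positivity
  have hh0 : 0 < h := by rw [hh]; positivity
  have hKhC : 2 * K * h * C ≤ 1 / 4 := by
    rw [hh]
    rw [show 2 * K * (1 / (8 * K * C + 1)) * C = (2 * K * C) / (8 * K * C + 1) by ring]
    rw [div_le_iff₀ hden]
    nlinarith [mul_nonneg hK0 hC]
  -- halving induction on the window
  have hP : ∀ j : ℕ, ∀ (k : ℤ) (u : ℝ), u ∈ Icc a (a + h) → ‖W k u‖ ≤ C / 2 ^ j := by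
    intro j
    induction j with
    | zero => intro k u _; simpa using hbd k u
    | succ j ih =>
      intro k u hu
      have hd : 0 ≤ C / 2 ^ j := by positivity
      have hdle : C / 2 ^ j ≤ C := div_le_self hC (one_le_pow₀ (by norm_num))
      have hwin := weighted_sq_le hε hW hK hd ih k u hu
      rw [h0 k, norm_zero, zero_pow two_ne_zero, mul_zero, zero_add] at hwin
      -- `e^{2u} − e^{2a} ≤ 2 (u − a) e^{2u} ≤ 2 h e^{2u}`
      have hexp : 0 < Real.exp (2 * u) := Real.exp_pos _
      have hua : 0 ≤ u - a := by linarith [hu.1]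
      have hgap : Real.exp (2 * u) - Real.exp (2 * a) ≤ 2 * h * Real.exp (2 * u) := by
        have h1 : 1 - 2 * (u - a) ≤ Real.exp (-(2 * (u - a))) := by
          linarith [Real.add_one_le_exp (-(2 * (u - a)))]
        have h2 : Real.exp (2 * a) = Real.exp (2 * u) * Real.exp (-(2 * (u - a))) := by
          rw [← Real.exp_add]; ring_nf
        rw [h2]
        have h3 : u - a ≤ h := by linarith [hu.2]
        nlinarith [mul_le_mul_of_nonneg_left h1 hexp.le, h3, hexp]
      have hKd3 : 0 ≤ K * (C / 2 ^ j) ^ 3 := by positivity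
      have h5 : Real.exp (2 * u) * ‖W k u‖ ^ 2 ≤ K * (C / 2 ^ j) ^ 3 * (2 * h * Real.exp (2 * u)) :=
        hwin.trans (mul_le_mul_of_nonneg_left hgap hKd3)
      have h6 : ‖W k u‖ ^ 2 ≤ 2 * K * h * (C / 2 ^ j) * (C / 2 ^ j) ^ 2 := by
        have : K * (C / 2 ^ j) ^ 3 * (2 * h * Real.exp (2 * u))
            = Real.exp (2 * u) * (2 * K * h * (C / 2 ^ j) * (C / 2 ^ j) ^ 2) := by ring
        rw [this] at h5
        exact le_of_mul_le_mul_left h5 hexp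
      have hcoef : 2 * K * h * (C / 2 ^ j) ≤ 1 / 4 := by
        have : 2 * K * h * (C / 2 ^ j) ≤ 2 * K * h * C :=
          mul_le_mul_of_nonneg_left hdle (by positivity)
        exact this.trans hKhC
      have h4 : ‖W k u‖ ^ 2 ≤ 1 / 4 * (C / 2 ^ j) ^ 2 :=
        h6.trans (mul_le_mul_of_nonneg_right hcoef (sq_nonneg _))
      have := le_half_of_sq_le (norm_nonneg _) hd h4
      rw [pow_succ, ← div_div]
      exact this
  intro n u hu
  by_contra hne
  have hpos : 0 < ‖W n u‖ := norm_pos_iff.2 hne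
  obtain ⟨j, hj⟩ := pow_unbounded_of_one_lt (C / ‖W n u‖) (by norm_num : (1 : ℝ) < 2)
  have h1 := hP j n u hu
  have h2 : C / 2 ^ j < ‖W n u‖ := by
    rw [div_lt_iff₀ (by positivity)]
    rw [div_lt_iff₀ hpos] at hj
    linarith [hj]
  linarith

/-- **Forward uniqueness from a zero slice.**  A uniformly bounded eternal solution that vanishes at every shell at
log-time `σ₁` vanishes for all `σ ≥ σ₁` (iterate the forward step). [cite: Tao2016AveragedNS, §4 Lemma 4.1 (4.8); cell theorem] -/
theorem eq_zero_after_of_eq_zero (hε : -1 < ε₀) (hW : IsEternalVisc ε₀ νh α W) (hU : UniformBound W) {K : ℝ}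
    (hK : shiftConst α (0, 0, 0) + bigLam ε₀ * shiftConst α (0, 0, 1)
      + (bigLam ε₀)⁻¹ * (shiftConst α (1, 0, 0) + shiftConst α (0, 1, 0)) ≤ K)
    {σ₁ : ℝ} (h0 : ∀ k : ℤ, W k σ₁ = 0) : ∀ (n : ℤ) (σ : ℝ), σ₁ ≤ σ → W n σ = 0 := by
  obtain ⟨C, hC⟩ := hU
  have hC0 : 0 ≤ C := (norm_nonneg _).trans (hC 0 0)
  have hK0 : 0 ≤ K := tableConst_nonneg hε hK
  set h : ℝ := 1 / (8 * K * C + 1) with hh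
  have hh0 : 0 < h := by rw [hh]; positivity
  -- induction over steps of length `h`
  have hstep : ∀ j : ℕ, ∀ (n : ℤ) (u : ℝ), u ∈ Icc σ₁ (σ₁ + j * h) → W n u = 0 := by
    intro j
    induction j with
    | zero =>
      intro n u hu
      simp only [Nat.cast_zero, zero_mul, add_zero] at hu
      have : u = σ₁ := le_antisymm hu.2 hu.1
      rw [this]; exact h0 n
    | succ j ih =>
      intro n u hu
      by_cases hle : u ≤ σ₁ + j * h
      · exact ih n u ⟨hu.1, hle⟩
      · push Not at hle
        have ha : ∀ k : ℤ, W k (σ₁ + j * h) = 0 :=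
          fun k => ih k _ ⟨by nlinarith [hh0.le], le_rfl⟩
        refine eq_zero_on_step hε hW hK hC0 hC ha n u ⟨hle.le, ?_⟩
        have := hu.2
        push_cast at this
        rw [← hh]
        linarith
  intro n σ hσ
  obtain ⟨j, hj⟩ := exists_nat_ge ((σ - σ₁) / h)
  refine hstep j n σ ⟨hσ, ?_⟩
  rw [div_le_iff₀ hh0] at hj
  linarith

/-! ## The backward amplitude floor -/

/-- **A uniformly bounded eternal solution that is quiet on a past half-line is identically zero.**  For any table
(no cancellation needed), any covariant viscosity `ν̂ ≥ 0`, any bound `K` of the table constant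
`C_Q + Λ C_A + Λ⁻¹ C_B`: if `‖W_k(σ)‖ ≤ δ` for all `k` and all `σ ≤ σ₁`, with `0 ≤ δ` and `K δ ≤ 1/4`, then `W ≡ 0`.
[cite: Tao2016AveragedNS, §4 Lemma 4.1 (4.8)–(4.10), §6.4; cell theorem] -/
theorem eq_zero_of_quiet_past (hε : -1 < ε₀) (hW : IsEternalVisc ε₀ νh α W) (hU : UniformBound W) {K δ σ₁ : ℝ}
    (hK : shiftConst α (0, 0, 0) + bigLam ε₀ * shiftConst α (0, 0, 1)
      + (bigLam ε₀)⁻¹ * (shiftConst α (1, 0, 0) + shiftConst α (0, 1, 0)) ≤ K)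
    (hδ : 0 ≤ δ) (hKδ : K * δ ≤ 1 / 4) (hq : ∀ (k : ℤ) (σ : ℝ), σ ≤ σ₁ → ‖W k σ‖ ≤ δ) :
    ∀ (n : ℤ) (σ : ℝ), W n σ = 0 := by
  have hpast := eq_zero_on_quiet_past hε hW hK hδ hKδ hq
  have hfut := eq_zero_after_of_eq_zero hε hW hU hK (fun k => hpast k σ₁ le_rfl)
  intro n σ
  rcases le_total σ σ₁ with hσ | hσ
  · exact hpast n σ hσ
  · exact hfut n σ hσ

/-- **Backward amplitude floor (the past of a non-trivial eternal solution is loud).**  A non-trivial uniformly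
bounded eternal solution of the renormalised lattice of ANY table, with ANY covariant viscosity `ν̂ ≥ 0`, exceeds the
amplitude `1/(4K)` at arbitrarily negative log-times: for every `σ₁` there are a shell `n` and a log-time `σ ≤ σ₁` with
`‖W_n(σ)‖ > 1/(4K)` (`K > 0` any bound of `C_Q + Λ C_A + Λ⁻¹ C_B`).  This is the non-degeneracy input of every
α-limit extraction from the hypothesis class of the tail ratchets.
[cite: Tao2016AveragedNS, §4 Lemma 4.1 (4.8)–(4.10), §6.4; cell theorem] -/
theorem past_loud (hε : -1 < ε₀) (hW : IsEternalVisc ε₀ νh α W) (hU : UniformBound W) {K : ℝ} (hK0 : 0 < K)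
    (hK : shiftConst α (0, 0, 0) + bigLam ε₀ * shiftConst α (0, 0, 1)
      + (bigLam ε₀)⁻¹ * (shiftConst α (1, 0, 0) + shiftConst α (0, 1, 0)) ≤ K)
    (hne : ∃ (n : ℤ) (σ : ℝ), W n σ ≠ 0) (σ₁ : ℝ) :
    ∃ (n : ℤ) (σ : ℝ), σ ≤ σ₁ ∧ 1 / (4 * K) < ‖W n σ‖ := by
  by_contra h
  push Not at h
  obtain ⟨n, σ, hnz⟩ := hne
  have hKδ : K * (1 / (4 * K)) ≤ 1 / 4 := by
    rw [show K * (1 / (4 * K)) = 1 / 4 by field_simp]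
  exact hnz (eq_zero_of_quiet_past hε hW hU hK (by positivity) hKδ
    (fun k σ hσ => h k σ hσ) n σ)

/-- The same floor read with `lim inf`-free quantifiers on the INVISCID class `IsEternal` (the hypothesis class of
`stub_inviscid` of the line `birth` and of stmt-25646). [cite: Tao2016AveragedNS, §4 Lemma 4.1 (4.8); cell theorem] -/
theorem past_loud_inviscid (hε : -1 < ε₀) {W : ℤ → ℝ → Em m} (hW : IsEternal ε₀ α W) (hU : UniformBound W)
    {K : ℝ} (hK0 : 0 < K)
    (hK : shiftConst α (0, 0, 0) + bigLam ε₀ * shiftConst α (0, 0, 1)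
      + (bigLam ε₀)⁻¹ * (shiftConst α (1, 0, 0) + shiftConst α (0, 1, 0)) ≤ K)
    (hne : ∃ (n : ℤ) (σ : ℝ), W n σ ≠ 0) (σ₁ : ℝ) :
    ∃ (n : ℤ) (σ : ℝ), σ ≤ σ₁ ∧ 1 / (4 * K) < ‖W n σ‖ :=
  past_loud hε hW.isEternalVisc hU hK0 hK hne σ₁

end WakeRatchetQuietPast

end Summit.NavierStokesRegularity.NavierStokesRegularity.Theorems

end
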